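import Summits.QuantumFields.YangMills.Theorems.FluctuationComparisonRegPrIntLTailSupOneChartRows
import HarnessLib

/-!
# `FluctuationComparisonRegPrIntLHaarTubeOneStep` — ⟨HAAR-TUBE₁⟩'S DOOR FROM THE CHARTS: a fibrewise LOWER charge of a target family read through a
# window chart of the block-averaging descent is a SETWISE lower charge (crux `FluctuationComparisonRegPrIntL`, stmt-QuantumFields-20520;
# LINE g22-4 ∕ g22-5, row TUBE∘ after LEAD w3-20520 g18's TUBE∘-SPLIT ⟨UP⟩ + ⟨LOW⟩ + ⟨HAAR-TUBE₁⟩)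

Cell `ym3-torus` (YM ladder rung R3 = continuum SU(2) Yang–Mills on T³ — a RUNG, NOT d = 4, NOT infinite volume, NOT a mass gap, NOT Clay);
width seat `ym3-torus-px8` (gen 14), explicit-unit helper; `--supports stmt-QuantumFields-20520 --as helper`.  THEOREMS ONLY (0 `def`, 0 `sorry`,
default heartbeats).

WHAT.  LEAD w3-20520 g18's split of TUBE∘ (`Lines/persistence_geometry.lean` row `SectionTubeMassIntCan`) isolates the pure one-step Haar kinematics
⟨HAAR-TUBE₁⟩: «`q′·dU_{J+1}(D⁻¹B) ≤ dU_{J+1}(D⁻¹B ∩ T_σ)` for measurable `B` in the interior window», `D = descendTo F ℰp J (J+1)`, `T_σ = {V | ∀ b,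
dist1 ((σ (D V) b)⁻¹ · V b) < r}` the `r`-link-tube around a section `σ` read on the fibre.  THIS FILE is its DOOR from a FIBREWISE chart letter, in the
currency of WREG's window charts (✓`…WregGlue.WindowChart`: `Φ`, `jac`, `descendTo_Φ`, `map_Φ`) — the LOWER twin of px20 g10's upper-row engine
✓`…TailSupOneChartRows.setwise_of_chartwise`:
* §1 GENERIC (support-form fibred chart `ν⌊(avg⁻¹U ∩ S) = Φ_*((μ⌊U ⊗ τ)·J)`, `J ≠ 0 ⇒ avg ∘ Φ = pr₁`; ANY measurable weight `w`, ANY target family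
  `E : α → Set β` — no measurability of `E` is asked, the right-hand side is an outer measure):
  `ae_lintegral_indicator_compl_mul_eq_zero` (off `S` the chart weight vanishes, a.e. on `U`) ·
  ★★ `mul_withDensity_preimage_inter_le_of_chartwise`: an a.e.-on-`U ∩ W` fibrewise letter `q·∫⁻ w(Φ)·J dτ ≤ ∫⁻ 1_{E V}(Φ)·w(Φ)·J dτ` gives
  `q·(ν·w)(avg⁻¹B ∩ S) ≤ (ν·w)(avg⁻¹B ∩ S ∩ {x | x ∈ E (avg x)})` for every measurable `B ⊆ U ∩ W` (measurable hull `toMeasurable` + px20's chart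
  formula ✓`setLIntegral_preimage_inter_eq_of_fibredChart` twice + the pointwise inclusion «`J ≠ 0`, `V ∈ B`, `Φ ∈ E V ∩ S` ⇒ `Φ` in the hull»);
* §2 THE WINDOW-CHART INSTANCES (any `J ≤ K`): ★★★ `withDensity_preimage_inter_target_of_windowChart` (any weight — at the Boltzmann weight this is a
  chart door for ⟨FIB-TUBE∘⟩ as well) · ★★★ `haar_preimage_inter_target_of_windowChart` (weight `1`: product Haar);
* §3 THE TUBE AT `K = J + 1`: ★★★ `haarTube_oneStep_of_windowChart` — ⟨HAAR-TUBE₁⟩ ON `O ∩ W`, RELATIVE TO THE CHART'S FINE SET `Sfine`: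
  `ofReal q′ · dU_{J+1}(D⁻¹B ∩ Sfine) ≤ dU_{J+1}(D⁻¹B ∩ Sfine ∩ T_σ)` for every measurable `B ⊆ O ∩ W`, `σ` ANY function; and
  `haarTube_oneStep_of_windowChart_univ` — the `Sfine = univ` reading, LEAD's literal text `ofReal q′ · dU(D⁻¹B) ≤ dU(D⁻¹B ∩ T_σ)`;
* §4 THE WHOLE WINDOW: ★★★ `haarTube_oneStep_of_windowCharts` — `W` open, a chart (same `Sfine`) with the fibrewise letter at every `U₀ ∈ W` ⟹ the
  `Sfine`-relative ⟨HAAR-TUBE₁⟩ for EVERY measurable `B ⊆ W` (px20's local-to-global patch ✓`restrict_le_smul_restrict_of_locally`).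
HONEST CURRENCY: a chart on `Sfine` sees only `D⁻¹O ∩ Sfine`, so the door is `Sfine`-relative; the fibrewise letter (the [Balaban1985Averaging] Prop. 1-type
lower volume bound, uniform over the closed window) is the HYPOTHESIS and is NOT proved here.

HONEST SCOPE.  Measure-theoretic plumbing over landed objects; nothing of Bałaban's asserted; ⟨HAAR-TUBE₁⟩'s fibrewise letter, ⟨UP⟩, ⟨LOW⟩, TUBE∘, PERS₁∘,
PLAQTAIL∘, LFR♯ᶜ∘, S2β, the crux 20520 and every rung statement are NOT proved; `YM3TorusSU2` NOT proved; the Yang–Mills mass gap (Clay) NOT proved.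

References: T. Bałaban, Commun. Math. Phys. **98** (1985) 17–51 [Balaban1985Averaging] ((10) p. 19, Prop. 1 p. 22); CMP **102** (1985) 255–275
[Balaban1985UV3] ((7) p. 257, (38)–(40) p. 266); CMP **109** (1987) 249–301 [Balaban1987RG1] ((0.4) p. 253, (2.10) p. 267).
-/

set_option autoImplicit false

noncomputable section

open MeasureTheory Set
open scoped ENNReal NNReal
open Literature.MathematicalPhysics.QuantumFieldTheory.Balaban1983to89
open Literature.MathematicalPhysics.QuantumFieldTheory.Balaban1983to89.T3ContinuumYM3Torus
open Literature.MathematicalPhysics.QuantumFieldTheory.Balaban1983to89.T3UnitLawDensityEML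
open Literature.MathematicalPhysics.QuantumFieldTheory.Balaban1983to89.T3TiltDescent
open scoped Literature.MathematicalPhysics.QuantumFieldTheory.Balaban1983to89.T3OrbitAverage
open Summit.QuantumFields.YangMills.Theorems.FluctuationComparisonRegPrIntLWregGlue (WindowChart)
open Summit.QuantumFields.YangMills.Theorems.FluctuationComparisonRegPrIntLTailSupOneChartRows
  (setLIntegral_preimage_inter_eq_of_fibredChart restrict_le_smul_restrict_of_locally)

namespace Summit.QuantumFields.YangMills.Theorems.FluctuationComparisonRegPrIntLHaarTubeOneStep

/-! ## §1 Generic: a fibrewise lower charge through a fibred chart is a setwise lower charge, for an ARBITRARY target family -/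

section Generic

variable {α β Z : Type*} [MeasurableSpace α] [MeasurableSpace β] [MeasurableSpace Z]
  {ν : Measure β} {μ : Measure α} {τ : Measure Z} {avg : β → α} {U : Set α} {S : Set β} {Φ : α × Z → β} {J : α × Z → ℝ≥0}

/-- **OFF `S` THE CHART WEIGHT VANISHES, a.e. ON `U`**: under the support-form chart identity `ν⌊(avg⁻¹U ∩ S) = Φ_*((μ⌊U ⊗ τ)·J)` (with `S` measurable),
for `μ`-a.e. `V ∈ U` the fibre integral `∫⁻ 1_{Sᶜ}(Φ(V,z))·w(Φ(V,z))·J(V,z) dτ` is `0` — the push-forward lives on `S` (`lintegral_map`, `withDensity`, Tonelli).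
[cite: Balaban1987RG1, (2.10) p.267 and (0.13) p.254] -/
theorem ae_lintegral_indicator_compl_mul_eq_zero [SFinite μ] [SFinite τ] (hU : MeasurableSet U) (hΦ : Measurable Φ) (hJ : Measurable J)
    (hmap : ν.restrict (avg ⁻¹' U ∩ S) = (((μ.restrict U).prod τ).withDensity (fun p => (J p : ℝ≥0∞))).map Φ)
    (hS : MeasurableSet S) {w : β → ℝ≥0∞} (hw : Measurable w) :
    ∀ᵐ V ∂μ, V ∈ U → ∫⁻ z, Sᶜ.indicator w (Φ (V, z)) * J (V, z) ∂τ = 0 := by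
  have hJ' : Measurable fun p : α × Z => (J p : ℝ≥0∞) := hJ.coe_nnreal_ennreal
  have hiw : Measurable (Sᶜ.indicator w) := hw.indicator hS.compl
  have hiwΦ : Measurable fun p : α × Z => Sᶜ.indicator w (Φ p) := hiw.comp hΦ
  have hg : Measurable fun p : α × Z => Sᶜ.indicator w (Φ p) * (J p : ℝ≥0∞) := hiwΦ.mul hJ'
  -- the double integral is the `ν⌊(avg⁻¹U ∩ S)`-integral of a function vanishing on `S`
  have h0 : ∫⁻ p, Sᶜ.indicator w (Φ p) * (J p : ℝ≥0∞) ∂((μ.restrict U).prod τ) = 0 := by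
    have h1 : ∫⁻ p, Sᶜ.indicator w (Φ p) * (J p : ℝ≥0∞) ∂((μ.restrict U).prod τ) =
        ∫⁻ x, Sᶜ.indicator w x ∂(ν.restrict (avg ⁻¹' U ∩ S)) := by
      rw [hmap, lintegral_map hiw hΦ, lintegral_withDensity_eq_lintegral_mul _ hJ' hiwΦ]
      exact lintegral_congr fun p => by simp only [Pi.mul_apply, mul_comm]
    rw [h1]
    refine le_antisymm ?_ zero_le
    calc ∫⁻ x in avg ⁻¹' U ∩ S, Sᶜ.indicator w x ∂ν ≤ ∫⁻ x in S, Sᶜ.indicator w x ∂ν := lintegral_mono_set inter_subset_right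
      _ = ∫⁻ x, S.indicator (Sᶜ.indicator w) x ∂ν := (lintegral_indicator hS _).symm
      _ = 0 := by
        rw [Set.indicator_indicator, Set.inter_compl_self, Set.indicator_empty]
        exact lintegral_zero
  rw [lintegral_prod _ hg.aemeasurable] at h0
  have h2 : ∀ᵐ V ∂(μ.restrict U), ∫⁻ z, Sᶜ.indicator w (Φ (V, z)) * (J (V, z) : ℝ≥0∞) ∂τ = 0 :=
    (lintegral_eq_zero_iff hg.lintegral_prod_right').mp h0
  exact (ae_restrict_iff' hU).mp h2

/-- ★★ **A FIBREWISE LOWER CHARGE THROUGH A FIBRED CHART IS A SETWISE LOWER CHARGE — FOR AN ARBITRARY TARGET FAMILY.**  Support-form fibred chart of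
`avg` over `U` on `S` (`hmap : ν⌊(avg⁻¹U ∩ S) = Φ_*((μ⌊U ⊗ τ)·J)`, `havgΦJ : J(V,z) ≠ 0 ⇒ avg(Φ(V,z)) = V`; `U`, `S` measurable), a measurable weight `w`,
ANY family of fine sets `E : α → Set β` (no measurability), any `W ⊆ α`.  If for `μ`-a.e. `V ∈ U ∩ W` the chart's `w`-weighted fibre integral charges `E V` with
fraction `q` — `q·∫⁻ w(Φ(V,z))·J(V,z) dτ ≤ ∫⁻ 1_{E V}(Φ(V,z))·w(Φ(V,z))·J(V,z) dτ` — then for every measurable `B ⊆ U ∩ W`: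
`q·(ν·w)(avg⁻¹B ∩ S) ≤ (ν·w)(avg⁻¹B ∩ S ∩ {x | x ∈ E (avg x)})` (outer measure on the right).  Proof: measurable hull `T := toMeasurable (ν·w) A ∩ S` of the
right-hand set `A`; px20's ✓`setLIntegral_preimage_inter_eq_of_fibredChart` on `S` and on `T`; pointwise on the chart «`J ≠ 0`, `V ∈ B`, `Φ ∈ E V ∩ S` ⇒
`Φ ∈ A ⊆ T`» by `havgΦJ`; the `Sᶜ`-part of the letter's right side is a.e. `0` (`ae_lintegral_indicator_compl_mul_eq_zero`).
[cite: Balaban1985Averaging, (10) p.19; Balaban1987RG1, (2.10) p.267] -/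
theorem mul_withDensity_preimage_inter_le_of_chartwise [SFinite μ] [SFinite τ] (hU : MeasurableSet U) (havg : Measurable avg)
    (hΦ : Measurable Φ) (hJ : Measurable J) (havgΦJ : ∀ V ∈ U, ∀ z, J (V, z) ≠ 0 → avg (Φ (V, z)) = V)
    (hmap : ν.restrict (avg ⁻¹' U ∩ S) = (((μ.restrict U).prod τ).withDensity (fun p => (J p : ℝ≥0∞))).map Φ)
    (hS : MeasurableSet S) {w : β → ℝ≥0∞} (hw : Measurable w) (E : α → Set β) (W : Set α) {q : ℝ≥0∞}
    (hfib : ∀ᵐ V ∂μ, V ∈ U ∩ W →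
      q * ∫⁻ z, w (Φ (V, z)) * J (V, z) ∂τ ≤ ∫⁻ z, (E V).indicator w (Φ (V, z)) * J (V, z) ∂τ) :
    ∀ B : Set α, MeasurableSet B → B ⊆ U ∩ W →
      q * (ν.withDensity w) (avg ⁻¹' B ∩ S) ≤ (ν.withDensity w) (avg ⁻¹' B ∩ S ∩ {x | x ∈ E (avg x)}) := by
  intro B hB hBUW
  have hBU : B ⊆ U := fun V hV => (hBUW hV).1
  set A : Set β := avg ⁻¹' B ∩ S ∩ {x | x ∈ E (avg x)} with hA_def
  set T : Set β := toMeasurable (ν.withDensity w) A ∩ S with hT_def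
  have hTm : MeasurableSet T := (measurableSet_toMeasurable _ _).inter hS
  have hTS : T ⊆ S := inter_subset_right
  have hJ' : Measurable fun p : α × Z => (J p : ℝ≥0∞) := hJ.coe_nnreal_ennreal
  -- the right-hand side dominates `(ν·w)(avg⁻¹B ∩ T)`
  have hR : (ν.withDensity w) (avg ⁻¹' B ∩ T) ≤ (ν.withDensity w) A :=
    calc (ν.withDensity w) (avg ⁻¹' B ∩ T) ≤ (ν.withDensity w) (toMeasurable (ν.withDensity w) A) := measure_mono fun x hx => hx.2.1
      _ = (ν.withDensity w) A := measure_toMeasurable A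
  -- both sides through the chart
  have hLHS : (ν.withDensity w) (avg ⁻¹' B ∩ S) = ∫⁻ V in B, (∫⁻ z, S.indicator w (Φ (V, z)) * J (V, z) ∂τ) ∂μ := by
    rw [withDensity_apply _ ((havg hB).inter hS)]
    exact setLIntegral_preimage_inter_eq_of_fibredChart hU havg hΦ hJ havgΦJ hmap hw hS subset_rfl hB hBU
  have hRHS : (ν.withDensity w) (avg ⁻¹' B ∩ T) = ∫⁻ V in B, (∫⁻ z, T.indicator w (Φ (V, z)) * J (V, z) ∂τ) ∂μ := by
    rw [withDensity_apply _ ((havg hB).inter hTm)]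
    exact setLIntegral_preimage_inter_eq_of_fibredChart hU havg hΦ hJ havgΦJ hmap hw hTm hTS hB hBU
  have hmeasS : Measurable fun V => ∫⁻ z, S.indicator w (Φ (V, z)) * (J (V, z) : ℝ≥0∞) ∂τ :=
    (((hw.indicator hS).comp hΦ).mul hJ').lintegral_prod_right'
  -- pointwise on `B`: `q·∫ 1_S w(Φ) J ≤ ∫ 1_T w(Φ) J`
  have hae0 := ae_lintegral_indicator_compl_mul_eq_zero hU hΦ hJ hmap hS hw
  have hkey : ∀ᵐ V ∂μ, V ∈ B →
      q * ∫⁻ z, S.indicator w (Φ (V, z)) * (J (V, z) : ℝ≥0∞) ∂τ ≤ ∫⁻ z, T.indicator w (Φ (V, z)) * (J (V, z) : ℝ≥0∞) ∂τ := by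
    filter_upwards [hfib, hae0] with V hV h0 hVB
    have hVU : V ∈ U := hBU hVB
    have h1 : q * ∫⁻ z, S.indicator w (Φ (V, z)) * (J (V, z) : ℝ≥0∞) ∂τ ≤ q * ∫⁻ z, w (Φ (V, z)) * (J (V, z) : ℝ≥0∞) ∂τ :=
      mul_le_mul_right (lintegral_mono fun z => mul_le_mul_left (Set.indicator_le_self S w (Φ (V, z))) _) _
    refine h1.trans ((hV (hBUW hVB)).trans ?_)
    have h2 : ∫⁻ z, (E V).indicator w (Φ (V, z)) * (J (V, z) : ℝ≥0∞) ∂τ ≤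
        ∫⁻ z, (T.indicator w (Φ (V, z)) * (J (V, z) : ℝ≥0∞) + Sᶜ.indicator w (Φ (V, z)) * (J (V, z) : ℝ≥0∞)) ∂τ := by
      refine lintegral_mono fun z => ?_
      by_cases hJ0 : J (V, z) = 0
      · simp [hJ0]
      by_cases hxE : Φ (V, z) ∈ E V
      · rw [Set.indicator_of_mem hxE]
        by_cases hxS : Φ (V, z) ∈ S
        · have havgV : avg (Φ (V, z)) = V := havgΦJ V hVU z hJ0
          have hxA : Φ (V, z) ∈ A := by
            refine ⟨⟨?_, hxS⟩, ?_⟩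
            · show avg (Φ (V, z)) ∈ B
              rw [havgV]; exact hVB
            · show Φ (V, z) ∈ E (avg (Φ (V, z)))
              rw [havgV]; exact hxE
          have hxT : Φ (V, z) ∈ T := ⟨subset_toMeasurable _ _ hxA, hxS⟩
          rw [Set.indicator_of_mem hxT]
          exact le_self_add
        · rw [Set.indicator_of_mem (Set.mem_compl hxS)]
          exact le_add_self
      · rw [Set.indicator_of_notMem hxE, zero_mul]
        exact zero_le
    refine h2.trans (le_of_eq ?_)
    have hmT : Measurable fun z => T.indicator w (Φ (V, z)) * (J (V, z) : ℝ≥0∞) :=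
      ((hw.indicator hTm).comp (hΦ.comp measurable_prodMk_left)).mul (hJ'.comp measurable_prodMk_left)
    rw [lintegral_add_left hmT, h0 hVU, add_zero]
  -- integrate over `B`
  calc q * (ν.withDensity w) (avg ⁻¹' B ∩ S)
      = ∫⁻ V in B, q * (∫⁻ z, S.indicator w (Φ (V, z)) * (J (V, z) : ℝ≥0∞) ∂τ) ∂μ := by
        rw [hLHS, lintegral_const_mul q hmeasS]
    _ ≤ ∫⁻ V in B, (∫⁻ z, T.indicator w (Φ (V, z)) * (J (V, z) : ℝ≥0∞) ∂τ) ∂μ := setLIntegral_mono_ae' hB hkey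
    _ = (ν.withDensity w) (avg ⁻¹' B ∩ T) := hRHS.symm
    _ ≤ (ν.withDensity w) A := hR

end Generic

/-! ## §2 The window-chart instances of the descent `D_{J,K}` (any `J ≤ K`) -/

section Runs

variable (F : T3Family) {J K : ℕ} (hJK : J ≤ K)

/-- ★★★ **ANY WEIGHT: A FIBREWISE LOWER CHARGE ON A WINDOW CHART IS A SETWISE LOWER CHARGE OF THE WEIGHTED PRODUCT HAAR MEASURE.**  For a window chart
`c : WindowChart F hJK Sfine O` (WREG glue), `O` open, `Sfine` measurable, a measurable weight `w` on run-`K` fields, ANY target family `E` indexed by level-`J`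
fields and any `W`: if for `dU_J`-a.e. `U ∈ O ∩ W`, `q·∫⁻ w(c.Φ(U,z))·c.jac(U,z) dU_K(z) ≤ ∫⁻ 1_{E U}(c.Φ(U,z))·w(c.Φ(U,z))·c.jac(U,z) dU_K(z)`, then for
every measurable `B ⊆ O ∩ W`: `q·(dU_K·w)(D_{J,K}⁻¹B ∩ Sfine) ≤ (dU_K·w)(D_{J,K}⁻¹B ∩ Sfine ∩ {V | V ∈ E (D_{J,K} V)})`.  At the Boltzmann weight
`w = e^{−β_K A}` the two sides are `Z_K·Gibbs_K`-masses (a chart door for ⟨FIB-TUBE∘⟩-type letters); at `w = 1` see below.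
[cite: Balaban1985Averaging, (10) p.19; Balaban1987RG1, (2.10) p.267; Balaban1985UV3, (7) p.257] -/
theorem withDensity_preimage_inter_target_of_windowChart
    {Sfine : Set (GaugeField (F.P K) 0 (Matrix.specialUnitaryGroup (Fin 2) ℂ))} {O : Set (GaugeField (F.P J) 0 (Matrix.specialUnitaryGroup (Fin 2) ℂ))}
    (c : WindowChart F hJK Sfine O) (hO : IsOpen O) (hS : MeasurableSet Sfine)
    {w : GaugeField (F.P K) 0 (Matrix.specialUnitaryGroup (Fin 2) ℂ) → ℝ≥0∞} (hw : Measurable w)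
    (E : GaugeField (F.P J) 0 (Matrix.specialUnitaryGroup (Fin 2) ℂ) → Set (GaugeField (F.P K) 0 (Matrix.specialUnitaryGroup (Fin 2) ℂ)))
    (W : Set (GaugeField (F.P J) 0 (Matrix.specialUnitaryGroup (Fin 2) ℂ))) {q : ℝ≥0∞}
    (hfib : ∀ᵐ U ∂(fieldMeasure (F.P J) 0 (Matrix.specialUnitaryGroup (Fin 2) ℂ)), U ∈ O ∩ W →
      q * ∫⁻ z, w (c.Φ (U, z)) * (c.jac (U, z) : ℝ≥0∞) ∂(fieldMeasure (F.P K) 0 (Matrix.specialUnitaryGroup (Fin 2) ℂ)) ≤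
        ∫⁻ z, (E U).indicator w (c.Φ (U, z)) * (c.jac (U, z) : ℝ≥0∞) ∂(fieldMeasure (F.P K) 0 (Matrix.specialUnitaryGroup (Fin 2) ℂ))) :
    ∀ B : Set (GaugeField (F.P J) 0 (Matrix.specialUnitaryGroup (Fin 2) ℂ)), MeasurableSet B → B ⊆ O ∩ W →
      q * ((fieldMeasure (F.P K) 0 (Matrix.specialUnitaryGroup (Fin 2) ℂ)).withDensity w) (descendTo F ℰp J K hJK ⁻¹' B ∩ Sfine) ≤
        ((fieldMeasure (F.P K) 0 (Matrix.specialUnitaryGroup (Fin 2) ℂ)).withDensity w)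
          (descendTo F ℰp J K hJK ⁻¹' B ∩ Sfine ∩ {V | V ∈ E (descendTo F ℰp J K hJK V)}) := by
  have hD : Measurable (descendTo F ℰp J K hJK) := measurable_descendTo F ℰp measurableE_ℰp hJK
  exact mul_withDensity_preimage_inter_le_of_chartwise hO.measurableSet hD c.measurable_Φ c.measurable_jac c.descendTo_Φ c.map_Φ hS hw E W hfib

/-- ★★★ **WEIGHT ONE: A FIBREWISE LOWER HAAR CHARGE ON A WINDOW CHART IS A SETWISE LOWER HAAR CHARGE.**  As above with `w = 1`: if for `dU_J`-a.e. `U ∈ O ∩ W`,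
`ofReal q·∫⁻ c.jac(U,z) dU_K(z) ≤ ∫⁻ 1_{E U}(c.Φ(U,z))·c.jac(U,z) dU_K(z)`, then for every measurable `B ⊆ O ∩ W`:
`ofReal q·dU_K(D_{J,K}⁻¹B ∩ Sfine) ≤ dU_K(D_{J,K}⁻¹B ∩ Sfine ∩ {V | V ∈ E (D_{J,K} V)})` — pure Haar kinematics of the averaging, no run, no Boltzmann weight.
[cite: Balaban1985Averaging, (10) p.19 and Prop. 1 p.22; Balaban1987RG1, (0.4) p.253] -/
theorem haar_preimage_inter_target_of_windowChart
    {Sfine : Set (GaugeField (F.P K) 0 (Matrix.specialUnitaryGroup (Fin 2) ℂ))} {O : Set (GaugeField (F.P J) 0 (Matrix.specialUnitaryGroup (Fin 2) ℂ))}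
    (c : WindowChart F hJK Sfine O) (hO : IsOpen O) (hS : MeasurableSet Sfine)
    (E : GaugeField (F.P J) 0 (Matrix.specialUnitaryGroup (Fin 2) ℂ) → Set (GaugeField (F.P K) 0 (Matrix.specialUnitaryGroup (Fin 2) ℂ)))
    (W : Set (GaugeField (F.P J) 0 (Matrix.specialUnitaryGroup (Fin 2) ℂ))) {q : ℝ}
    (hfib : ∀ᵐ U ∂(fieldMeasure (F.P J) 0 (Matrix.specialUnitaryGroup (Fin 2) ℂ)), U ∈ O ∩ W →
      ENNReal.ofReal q * ∫⁻ z, (c.jac (U, z) : ℝ≥0∞) ∂(fieldMeasure (F.P K) 0 (Matrix.specialUnitaryGroup (Fin 2) ℂ)) ≤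
        ∫⁻ z, (E U).indicator (fun _ => (1 : ℝ≥0∞)) (c.Φ (U, z)) * (c.jac (U, z) : ℝ≥0∞)
          ∂(fieldMeasure (F.P K) 0 (Matrix.specialUnitaryGroup (Fin 2) ℂ))) :
    ∀ B : Set (GaugeField (F.P J) 0 (Matrix.specialUnitaryGroup (Fin 2) ℂ)), MeasurableSet B → B ⊆ O ∩ W →
      ENNReal.ofReal q * fieldMeasure (F.P K) 0 (Matrix.specialUnitaryGroup (Fin 2) ℂ) (descendTo F ℰp J K hJK ⁻¹' B ∩ Sfine) ≤
        fieldMeasure (F.P K) 0 (Matrix.specialUnitaryGroup (Fin 2) ℂ)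
          (descendTo F ℰp J K hJK ⁻¹' B ∩ Sfine ∩ {V | V ∈ E (descendTo F ℰp J K hJK V)}) := by
  have h := withDensity_preimage_inter_target_of_windowChart F hJK c hO hS
    (w := fun _ => (1 : ℝ≥0∞)) measurable_const E W (q := ENNReal.ofReal q) (by
      filter_upwards [hfib] with U hU hUOW
      simpa only [one_mul] using hU hUOW)
  intro B hB hBOW
  have h1 := h B hB hBOW
  have hone : (fun _ : GaugeField (F.P K) 0 (Matrix.specialUnitaryGroup (Fin 2) ℂ) => (1 : ℝ≥0∞)) = 1 := rfl
  rwa [hone, withDensity_one] at h1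

end Runs

/-! ## §3 The tube at `K = J + 1`: ⟨HAAR-TUBE₁⟩ on `O ∩ W` from a fibrewise chart letter -/

section Tube

variable (F : T3Family) {J : ℕ}

/-- ★★★ **⟨HAAR-TUBE₁⟩ ON `O ∩ W` FROM THE CHARTS** (LEAD w3-20520 g18's TUBE∘-SPLIT letter, `Sfine`-relative).  One step `D = D_{J,J+1} = descendTo F ℰp J (J+1)`,
a window chart `c : WindowChart F (Nat.le_succ J) Sfine O`, `O` open, `Sfine` measurable, ANY section `σ` (no measurability), radius `r`, any `W`.  If for
`dU_J`-a.e. `U ∈ O ∩ W` the chart's Haar fibre over `U` charges the `r`-link-tube around `σ U` with fraction `q′` —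
`ofReal q′·∫⁻ c.jac(U,z) dU_{J+1}(z) ≤ ∫⁻ 1_{tube_r(σ U)}(c.Φ(U,z))·c.jac(U,z) dU_{J+1}(z)`, `tube_r(σ U) = {V | ∀ b, dist1 ((σ U b)⁻¹·V b) < r}` —
then for every measurable `B ⊆ O ∩ W`:
`ofReal q′·dU_{J+1}(D⁻¹B ∩ Sfine) ≤ dU_{J+1}(D⁻¹B ∩ Sfine ∩ {V | ∀ b, dist1 ((σ (D V) b)⁻¹·V b) < r})`.
The fibrewise letter (a [Balaban1985Averaging] Prop. 1-type lower volume bound, uniform over the closed window) is the hypothesis — NOT proved here.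
[cite: Balaban1985Averaging, (10) p.19 and Prop. 1 p.22; Balaban1985UV3, (7) p.257 and (38)-(40) p.266; Balaban1987RG1, (0.4) p.253] -/
theorem haarTube_oneStep_of_windowChart
    {Sfine : Set (GaugeField (F.P (J + 1)) 0 (Matrix.specialUnitaryGroup (Fin 2) ℂ))}
    {O : Set (GaugeField (F.P J) 0 (Matrix.specialUnitaryGroup (Fin 2) ℂ))}
    (c : WindowChart F (Nat.le_succ J) Sfine O) (hO : IsOpen O) (hS : MeasurableSet Sfine)
    (σ : GaugeField (F.P J) 0 (Matrix.specialUnitaryGroup (Fin 2) ℂ) → GaugeField (F.P (J + 1)) 0 (Matrix.specialUnitaryGroup (Fin 2) ℂ))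
    (r : ℝ) (W : Set (GaugeField (F.P J) 0 (Matrix.specialUnitaryGroup (Fin 2) ℂ))) {q : ℝ}
    (hfib : ∀ᵐ U ∂(fieldMeasure (F.P J) 0 (Matrix.specialUnitaryGroup (Fin 2) ℂ)), U ∈ O ∩ W →
      ENNReal.ofReal q * ∫⁻ z, (c.jac (U, z) : ℝ≥0∞) ∂(fieldMeasure (F.P (J + 1)) 0 (Matrix.specialUnitaryGroup (Fin 2) ℂ)) ≤
        ∫⁻ z, {V : GaugeField (F.P (J + 1)) 0 (Matrix.specialUnitaryGroup (Fin 2) ℂ) |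
            ∀ b : PBond (F.P (J + 1)) 0, dist1 ((σ U b)⁻¹ * V b) < r}.indicator (fun _ => (1 : ℝ≥0∞)) (c.Φ (U, z)) *
          (c.jac (U, z) : ℝ≥0∞) ∂(fieldMeasure (F.P (J + 1)) 0 (Matrix.specialUnitaryGroup (Fin 2) ℂ))) :
    ∀ B : Set (GaugeField (F.P J) 0 (Matrix.specialUnitaryGroup (Fin 2) ℂ)), MeasurableSet B → B ⊆ O ∩ W →
      ENNReal.ofReal q * fieldMeasure (F.P (J + 1)) 0 (Matrix.specialUnitaryGroup (Fin 2) ℂ)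
          (descendTo F ℰp J (J + 1) (Nat.le_succ J) ⁻¹' B ∩ Sfine) ≤
        fieldMeasure (F.P (J + 1)) 0 (Matrix.specialUnitaryGroup (Fin 2) ℂ)
          (descendTo F ℰp J (J + 1) (Nat.le_succ J) ⁻¹' B ∩ Sfine ∩
            {V | ∀ b : PBond (F.P (J + 1)) 0, dist1 ((σ (descendTo F ℰp J (J + 1) (Nat.le_succ J) V) b)⁻¹ * V b) < r}) :=
  haar_preimage_inter_target_of_windowChart F (Nat.le_succ J) c hO hS
    (fun U => {V : GaugeField (F.P (J + 1)) 0 (Matrix.specialUnitaryGroup (Fin 2) ℂ) | ∀ b : PBond (F.P (J + 1)) 0, dist1 ((σ U b)⁻¹ * V b) < r})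
    W hfib

/-- **THE `Sfine = univ` READING** (LEAD w3-20520 g18's literal ⟨HAAR-TUBE₁⟩ text): for a window chart of the one-step descent on the WHOLE fine space
(`Sfine = univ`), the fibrewise tube letter a.e. on `O ∩ W` gives `ofReal q′·dU_{J+1}(D⁻¹B) ≤ dU_{J+1}(D⁻¹B ∩ T_σ)` for every measurable `B ⊆ O ∩ W`.
[cite: Balaban1985Averaging, (10) p.19 and Prop. 1 p.22; Balaban1987RG1, (0.4) p.253] -/
theorem haarTube_oneStep_of_windowChart_univ
    {O : Set (GaugeField (F.P J) 0 (Matrix.specialUnitaryGroup (Fin 2) ℂ))}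
    (c : WindowChart F (Nat.le_succ J) (Set.univ : Set (GaugeField (F.P (J + 1)) 0 (Matrix.specialUnitaryGroup (Fin 2) ℂ))) O) (hO : IsOpen O)
    (σ : GaugeField (F.P J) 0 (Matrix.specialUnitaryGroup (Fin 2) ℂ) → GaugeField (F.P (J + 1)) 0 (Matrix.specialUnitaryGroup (Fin 2) ℂ))
    (r : ℝ) (W : Set (GaugeField (F.P J) 0 (Matrix.specialUnitaryGroup (Fin 2) ℂ))) {q : ℝ}
    (hfib : ∀ᵐ U ∂(fieldMeasure (F.P J) 0 (Matrix.specialUnitaryGroup (Fin 2) ℂ)), U ∈ O ∩ W →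
      ENNReal.ofReal q * ∫⁻ z, (c.jac (U, z) : ℝ≥0∞) ∂(fieldMeasure (F.P (J + 1)) 0 (Matrix.specialUnitaryGroup (Fin 2) ℂ)) ≤
        ∫⁻ z, {V : GaugeField (F.P (J + 1)) 0 (Matrix.specialUnitaryGroup (Fin 2) ℂ) |
            ∀ b : PBond (F.P (J + 1)) 0, dist1 ((σ U b)⁻¹ * V b) < r}.indicator (fun _ => (1 : ℝ≥0∞)) (c.Φ (U, z)) *
          (c.jac (U, z) : ℝ≥0∞) ∂(fieldMeasure (F.P (J + 1)) 0 (Matrix.specialUnitaryGroup (Fin 2) ℂ))) :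
    ∀ B : Set (GaugeField (F.P J) 0 (Matrix.specialUnitaryGroup (Fin 2) ℂ)), MeasurableSet B → B ⊆ O ∩ W →
      ENNReal.ofReal q * fieldMeasure (F.P (J + 1)) 0 (Matrix.specialUnitaryGroup (Fin 2) ℂ)
          (descendTo F ℰp J (J + 1) (Nat.le_succ J) ⁻¹' B) ≤
        fieldMeasure (F.P (J + 1)) 0 (Matrix.specialUnitaryGroup (Fin 2) ℂ)
          (descendTo F ℰp J (J + 1) (Nat.le_succ J) ⁻¹' B ∩
            {V | ∀ b : PBond (F.P (J + 1)) 0, dist1 ((σ (descendTo F ℰp J (J + 1) (Nat.le_succ J) V) b)⁻¹ * V b) < r}) := by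
  intro B hB hBOW
  have h := haarTube_oneStep_of_windowChart F c hO MeasurableSet.univ σ r W hfib B hB hBOW
  simpa only [Set.inter_univ] using h

end Tube

/-! ## §4 (v1.1) THE DOOR ON THE WHOLE WINDOW from a chart at every datum (local-to-global patch) -/

section Window

variable (F : T3Family) {J : ℕ}

/-- ★★★ **⟨HAAR-TUBE₁⟩ ON THE WHOLE WINDOW FROM A CHART AT EVERY DATUM** (`Sfine` fixed, e.g. the UV-small history event of ✓`WindowChartsExist`): `W` open
(e.g. `{U | PlaqSmall (θBal F.L γ (c·b₀) p₀ J) U}`), `Sfine` measurable, `σ` ANY function, radius `r`; if every `U₀ ∈ W` has a window chart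
`c : WindowChart F (Nat.le_succ J) Sfine O` over an open `O ∋ U₀` whose Haar fibres charge the `r`-link-tube around `σ U` with fraction `q′` for `dU_J`-a.e.
`U ∈ O ∩ W`, then for EVERY measurable `B ⊆ W`: `ofReal q′·dU_{J+1}(D⁻¹B ∩ Sfine) ≤ dU_{J+1}(D⁻¹B ∩ Sfine ∩ T_σ)` (§3 on each `O ∩ W`, then px20's
local-to-global patch ✓`restrict_le_smul_restrict_of_locally` on the two push-forwards `D_*(q′·dU⌊Sfine)` and `D_*(dU⌊(Sfine ∩ T_σ))`).
[cite: Balaban1985Averaging, (10) p.19 and Prop. 1 p.22; Balaban1987RG1, (0.4) p.253 and (2.10) p.267] -/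
theorem haarTube_oneStep_of_windowCharts
    {Sfine : Set (GaugeField (F.P (J + 1)) 0 (Matrix.specialUnitaryGroup (Fin 2) ℂ))} (hS : MeasurableSet Sfine)
    {W : Set (GaugeField (F.P J) 0 (Matrix.specialUnitaryGroup (Fin 2) ℂ))} (hW : IsOpen W)
    (σ : GaugeField (F.P J) 0 (Matrix.specialUnitaryGroup (Fin 2) ℂ) → GaugeField (F.P (J + 1)) 0 (Matrix.specialUnitaryGroup (Fin 2) ℂ))
    (r : ℝ) {q : ℝ}
    (h : ∀ U₀ ∈ W, ∃ (O : Set (GaugeField (F.P J) 0 (Matrix.specialUnitaryGroup (Fin 2) ℂ)))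
        (c : WindowChart F (Nat.le_succ J) Sfine O), IsOpen O ∧ U₀ ∈ O ∧
        ∀ᵐ U ∂(fieldMeasure (F.P J) 0 (Matrix.specialUnitaryGroup (Fin 2) ℂ)), U ∈ O ∩ W →
          ENNReal.ofReal q * ∫⁻ z, (c.jac (U, z) : ℝ≥0∞) ∂(fieldMeasure (F.P (J + 1)) 0 (Matrix.specialUnitaryGroup (Fin 2) ℂ)) ≤
            ∫⁻ z, {V : GaugeField (F.P (J + 1)) 0 (Matrix.specialUnitaryGroup (Fin 2) ℂ) |
                ∀ b : PBond (F.P (J + 1)) 0, dist1 ((σ U b)⁻¹ * V b) < r}.indicator (fun _ => (1 : ℝ≥0∞)) (c.Φ (U, z)) *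
              (c.jac (U, z) : ℝ≥0∞) ∂(fieldMeasure (F.P (J + 1)) 0 (Matrix.specialUnitaryGroup (Fin 2) ℂ))) :
    ∀ B : Set (GaugeField (F.P J) 0 (Matrix.specialUnitaryGroup (Fin 2) ℂ)), MeasurableSet B → B ⊆ W →
      ENNReal.ofReal q * fieldMeasure (F.P (J + 1)) 0 (Matrix.specialUnitaryGroup (Fin 2) ℂ)
          (descendTo F ℰp J (J + 1) (Nat.le_succ J) ⁻¹' B ∩ Sfine) ≤
        fieldMeasure (F.P (J + 1)) 0 (Matrix.specialUnitaryGroup (Fin 2) ℂ)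
          (descendTo F ℰp J (J + 1) (Nat.le_succ J) ⁻¹' B ∩ Sfine ∩
            {V | ∀ b : PBond (F.P (J + 1)) 0, dist1 ((σ (descendTo F ℰp J (J + 1) (Nat.le_succ J) V) b)⁻¹ * V b) < r}) := by
  set D := descendTo F ℰp J (J + 1) (Nat.le_succ J) with hD_def
  set T : Set (GaugeField (F.P (J + 1)) 0 (Matrix.specialUnitaryGroup (Fin 2) ℂ)) :=
    {V | ∀ b : PBond (F.P (J + 1)) 0, dist1 ((σ (D V) b)⁻¹ * V b) < r} with hT_def
  have hD : Measurable D := measurable_descendTo F ℰp measurableE_ℰp (Nat.le_succ J)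
  -- the two push-forwards
  set μ₁ : Measure (GaugeField (F.P J) 0 (Matrix.specialUnitaryGroup (Fin 2) ℂ)) :=
    ((ENNReal.ofReal q • fieldMeasure (F.P (J + 1)) 0 (Matrix.specialUnitaryGroup (Fin 2) ℂ)).restrict Sfine).map D with hμ₁_def
  set μ₂ : Measure (GaugeField (F.P J) 0 (Matrix.specialUnitaryGroup (Fin 2) ℂ)) :=
    ((fieldMeasure (F.P (J + 1)) 0 (Matrix.specialUnitaryGroup (Fin 2) ℂ)).restrict (Sfine ∩ T)).map D with hμ₂_def
  have hμ₁ : ∀ B, MeasurableSet B →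
      μ₁ B = ENNReal.ofReal q * fieldMeasure (F.P (J + 1)) 0 (Matrix.specialUnitaryGroup (Fin 2) ℂ) (D ⁻¹' B ∩ Sfine) := by
    intro B hB
    rw [hμ₁_def, Measure.map_apply hD hB, Measure.restrict_apply (hD hB), Measure.smul_apply, smul_eq_mul]
  have hμ₂ : ∀ B, MeasurableSet B →
      μ₂ B = fieldMeasure (F.P (J + 1)) 0 (Matrix.specialUnitaryGroup (Fin 2) ℂ) (D ⁻¹' B ∩ Sfine ∩ T) := by
    intro B hB
    rw [hμ₂_def, Measure.map_apply hD hB, Measure.restrict_apply (hD hB), Set.inter_assoc]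
  -- locally, §3
  have hloc : ∀ U₀ ∈ W, ∃ O : Set (GaugeField (F.P J) 0 (Matrix.specialUnitaryGroup (Fin 2) ℂ)), IsOpen O ∧ U₀ ∈ O ∧
      μ₁.restrict (O ∩ W) ≤ (1 : ℝ≥0∞) • μ₂.restrict (O ∩ W) := by
    intro U₀ hU₀
    obtain ⟨O, c, hO, hU₀O, hfib⟩ := h U₀ hU₀
    refine ⟨O, hO, hU₀O, ?_⟩
    rw [one_smul]
    refine Measure.le_iff.mpr fun A hA => ?_
    have hOW : MeasurableSet (O ∩ W) := hO.measurableSet.inter hW.measurableSet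
    rw [Measure.restrict_apply hA, Measure.restrict_apply hA, hμ₁ _ (hA.inter hOW), hμ₂ _ (hA.inter hOW)]
    exact haarTube_oneStep_of_windowChart F c hO hS σ r W hfib (A ∩ (O ∩ W)) (hA.inter hOW) Set.inter_subset_right
  have hglob := restrict_le_smul_restrict_of_locally μ₁ μ₂ hW.measurableSet hloc
  rw [one_smul] at hglob
  intro B hB hBW
  have h1 := (Measure.le_iff.mp hglob) B hB
  rw [Measure.restrict_apply hB, Measure.restrict_apply hB, Set.inter_eq_left.mpr hBW, hμ₁ B hB, hμ₂ B hB] at h1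
  exact h1

end Window

end Summit.QuantumFields.YangMills.Theorems.FluctuationComparisonRegPrIntLHaarTubeOneStep

end
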